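import Literature.NumberTheory.LFunctions.SelbergArgOmegaKernel
import Literature.NumberTheory.LFunctions.PrimeTrigPolyFirstMomentWindow
import Literature.NumberTheory.LFunctions.PrimeReciprocalCosSum
import HarnessLib

/-!
# The prime side of the smoothed `S(t+h) − S(t)`: identification and first moment

Topic `Literature/NumberTheory/LFunctions`. Everything in this file is PROVED; the one definition
is the coefficient sequence `deltaCoef`.

In the `L¹` theory of `S(t+h) − S(t)` built on the explicit formula for the dilated
Rudnick–Sarnak test function (`Literature.NumberTheory.LFunctions.SelbergOmega`), the prime side
enters through `Re (𝒱_τ(u+h) − 𝒱_τ(u))`, `𝒱_τ = SelbergOmega.primeV τ`. We identify it with the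
imaginary part of the trigonometric polynomial `∑_{n ≤ e^{τ/4}} b_n n^{iu}`,
`b_n = 2Λ(n) g_τ(log n)(n^{ih} − 1)/(√n log n)` (`re_primeV_sub_eq`), separate the primes from the
higher prime powers (whose contribution is `O(W)` in `L¹` on a window of length `W` by the mean
value theorem, with an absolute constant), bound the prime coefficients, and bound the variance
`∑_p |b_p|²` from below by `c log(τh) − C` (Mertens and `∑ cos(h log p)/p`, Titchmarsh (9.25.2)).
The outcome `primeSide_lower` is the lower bound `≫ W (√(log(τ h)) − O(1))` for
`∫_W |Re(𝒱_τ(u+h) − 𝒱_τ(u))| du` used in Selberg's bound `∫_T^{2T} |S(t+h) − S(t)| dt ≫ T`.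

## References

* E. C. Titchmarsh, *The Theory of the Riemann Zeta-Function*, 2nd ed. (1986), §9.25 (9.25.2),
  §9.26. [cite: Titchmarsh1986, §9.26]
* A. Selberg, *Contributions to the theory of the Riemann zeta-function* (1946), §7.
-/

noncomputable section

open Complex Real MeasureTheory Set Filter Finset intervalIntegral
open scoped ArithmeticFunction.vonMangoldt

namespace Literature.NumberTheory.LFunctions.SelbergDelta

open Literature.NumberTheory.LFunctions.SelbergOmega
open Literature.NumberTheory.LFunctions.RudnickSarnakN
open Literature.NumberTheory.LFunctions.PrimeTrigPoly

/-! ### The coefficients -/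

/-- The coefficients of the prime side of the smoothed `S(t+h) − S(t)`:
`b_n = 2Λ(n) g_τ(log n) (n^{ih} − 1)/(√n log n)`. [cite: Titchmarsh1986, §9.26] -/
def deltaCoef (τ h : ℝ) (n : ℕ) : ℂ :=
  2 * ((Λ n : ℝ) : ℂ) * gDil τ (Real.log n) / ((Real.sqrt n : ℂ) * (Real.log n : ℂ)) *
    ((n : ℂ) ^ ((h : ℂ) * I) - 1)

/-- Unfolding `deltaCoef`. [folklore] -/
theorem deltaCoef_def (τ h : ℝ) (n : ℕ) : deltaCoef τ h n =
    2 * ((Λ n : ℝ) : ℂ) * gDil τ (Real.log n) / ((Real.sqrt n : ℂ) * (Real.log n : ℂ)) *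
      ((n : ℂ) ^ ((h : ℂ) * I) - 1) := rfl

/-- `b_n = 0` when `Λ(n) = 0`. [folklore] -/
theorem deltaCoef_eq_zero_of_vonMangoldt {τ h : ℝ} {n : ℕ} (hn : Λ n = 0) : deltaCoef τ h n = 0 := by
  simp [deltaCoef, hn]

/-- `n^{it} = e^{i t log n}` for `n ≥ 1`. [folklore] -/
theorem natCast_cpow_eq (n : ℕ) (hn : n ≠ 0) (t : ℝ) :
    (n : ℂ) ^ ((t : ℂ) * I) = cexp (((t * Real.log n : ℝ) : ℂ) * I) := by
  rw [Complex.cpow_def_of_ne_zero (by exact_mod_cast hn), ← Complex.natCast_log]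
  congr 1; push_cast; ring

/-- `|n^{it}| = 1` for `n ≥ 1`. [folklore] -/
theorem norm_natCast_cpow (n : ℕ) (hn : n ≠ 0) (t : ℝ) : ‖(n : ℂ) ^ ((t : ℂ) * I)‖ = 1 := by
  rw [natCast_cpow_eq n hn, Complex.norm_exp_ofReal_mul_I]

/-- `(i/ℓ)(e^{-ixℓ} − e^{ixℓ}) = 2 sin(xℓ)/ℓ`. [folklore] -/
theorem I_div_mul_cexp_sub (x : ℝ) {ℓ : ℝ} (hℓ : ℓ ≠ 0) :
    (I / (ℓ : ℂ)) * (cexp ((((-(x * ℓ)) : ℝ) : ℂ) * I) - cexp (((x * ℓ : ℝ) : ℂ) * I)) =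
      ((2 * Real.sin (x * ℓ) / ℓ : ℝ) : ℂ) := by
  have h1 : cexp ((((-(x * ℓ)) : ℝ) : ℂ) * I) = Complex.cos ((x : ℂ) * ℓ) - Complex.sin ((x : ℂ) * ℓ) * I := by
    rw [Complex.exp_mul_I]; push_cast; rw [Complex.cos_neg, Complex.sin_neg]; ring
  have h2 : cexp (((x * ℓ : ℝ) : ℂ) * I) = Complex.cos ((x : ℂ) * ℓ) + Complex.sin ((x : ℂ) * ℓ) * I := by
    rw [Complex.exp_mul_I]; push_cast; ring
  rw [h1, h2]
  have hℓ' : (ℓ : ℂ) ≠ 0 := ofReal_ne_zero.2 hℓ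
  push_cast
  field_simp
  ring_nf
  rw [I_sq]; ring

/-- One term of `𝒱_τ`: for `n ≥ 2`,
`Λ(n) n^{-1/2} g_τ(log n) (i/log n)(e^{-ix log n} − e^{ix log n}) = 2Λ(n) Re g_τ(log n) sin(x log n)/(√n log n)`,
a real number. [folklore] -/
theorem primeV_term_eq (τ x : ℝ) {n : ℕ} (hn : 2 ≤ n) :
    ((Λ n : ℝ) : ℂ) / (Real.sqrt n : ℂ) *
      (gDil τ (Real.log n) * ((I / (Real.log n : ℂ)) * (cexp ((((-(x * Real.log n)) : ℝ) : ℂ) * I) -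
        cexp (((x * Real.log n : ℝ) : ℂ) * I)))) =
      ((Λ n * (gDil τ (Real.log n)).re * (2 * Real.sin (x * Real.log n) / Real.log n) / Real.sqrt n : ℝ) : ℂ) := by
  have hℓ : Real.log n ≠ 0 := (Real.log_pos (by exact_mod_cast hn : (1 : ℝ) < n)).ne'
  rw [I_div_mul_cexp_sub x hℓ]
  conv_lhs => rw [gDil_eq_re τ (Real.log n)]
  push_cast
  ring

/-- One term of `∑ b_n n^{iu}`: for `n ≥ 2`,
`Im (b_n n^{iu}) = 2Λ(n) Re g_τ(log n) (sin((u+h) log n) − sin(u log n))/(√n log n)`. [folklore] -/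
theorem im_deltaCoef_mul_cpow (τ h u : ℝ) {n : ℕ} (hn : 2 ≤ n) :
    (deltaCoef τ h n * (n : ℂ) ^ ((u : ℂ) * I)).im =
      Λ n * (gDil τ (Real.log n)).re * (2 * (Real.sin ((u + h) * Real.log n) - Real.sin (u * Real.log n)) / Real.log n) /
        Real.sqrt n := by
  have hn0 : n ≠ 0 := by omega
  have hℓ : Real.log n ≠ 0 := (Real.log_pos (by exact_mod_cast hn : (1 : ℝ) < n)).ne'
  have hsq : (Real.sqrt n : ℝ) ≠ 0 := (Real.sqrt_pos.2 (by exact_mod_cast (by omega : 0 < n))).ne'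
  rw [deltaCoef]
  conv_lhs => rw [gDil_eq_re τ (Real.log n)]
  rw [mul_assoc, sub_mul, one_mul, ← Complex.cpow_add _ _ (by exact_mod_cast hn0),
    show (h : ℂ) * I + (u : ℂ) * I = (((u + h : ℝ)) : ℂ) * I by push_cast; ring,
    natCast_cpow_eq n hn0, natCast_cpow_eq n hn0]
  have e : 2 * ((Λ n : ℝ) : ℂ) * (((gDil τ (Real.log n)).re : ℝ) : ℂ) / ((Real.sqrt n : ℂ) * (Real.log n : ℂ)) =
      ((2 * Λ n * (gDil τ (Real.log n)).re / (Real.sqrt n * Real.log n) : ℝ) : ℂ) := by push_cast; ring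
  rw [e, Complex.im_ofReal_mul, Complex.sub_im, Complex.exp_ofReal_mul_I_im, Complex.exp_ofReal_mul_I_im]
  field_simp

/-- **The prime side is the imaginary part of a trigonometric polynomial.** For `τ > 0`:
`Re (𝒱_τ(u+h) − 𝒱_τ(u)) = Im ∑_{n ≤ e^{τ/4}} b_n n^{iu}`. [cite: Titchmarsh1986, §9.26] -/
theorem re_primeV_sub_eq (τ h u : ℝ) :
    (primeV τ (u + h) - primeV τ u).re =
      (∑ n ∈ Finset.range (nCut τ + 1), deltaCoef τ h n * (n : ℂ) ^ ((u : ℂ) * I)).im := by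
  unfold primeV
  rw [← Finset.sum_sub_distrib, Complex.re_sum, Complex.im_sum]
  refine Finset.sum_congr rfl fun n _ => ?_
  rcases Nat.lt_or_ge n 2 with hn | hn
  · interval_cases n <;> simp [deltaCoef]
  · rw [Complex.sub_re, primeV_term_eq τ (u + h) hn, primeV_term_eq τ u hn, Complex.ofReal_re, Complex.ofReal_re,
      im_deltaCoef_mul_cpow τ h u hn]
    have hℓ : Real.log n ≠ 0 := (Real.log_pos (by exact_mod_cast hn : (1 : ℝ) < n)).ne'
    have hsq : (Real.sqrt n : ℝ) ≠ 0 := (Real.sqrt_pos.2 (by exact_mod_cast (by omega : 0 < n))).ne'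
    field_simp

/-! ### Size of the coefficients -/

/-- `|b_n| ≤ 4 ‖bump‖₁ /√n` for `n ≥ 2` (`Λ(n) ≤ log n`, `|g_τ| ≤ ‖bump‖₁`, `|n^{ih} − 1| ≤ 2`); and
`b_n = 0` for `n ≤ 1`. [folklore] -/
theorem norm_deltaCoef_le (τ h : ℝ) (n : ℕ) : ‖deltaCoef τ h n‖ ≤ 4 * bumpMass / Real.sqrt n := by
  rcases Nat.lt_or_ge n 2 with hn | hn
  · have hb := bumpMass_pos
    interval_cases n <;> simp [deltaCoef] ; positivity
  have hn0 : n ≠ 0 := by omega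
  have hn1 : (1 : ℝ) < n := by exact_mod_cast hn
  have hℓ : 0 < Real.log n := Real.log_pos hn1
  have hsq : 0 < Real.sqrt n := Real.sqrt_pos.2 (by linarith)
  rw [deltaCoef, norm_mul, norm_div, norm_mul, norm_mul, norm_mul, Complex.norm_real, Complex.norm_real,
    Complex.norm_real, Real.norm_eq_abs, Real.norm_eq_abs, Real.norm_eq_abs,
    abs_of_nonneg ArithmeticFunction.vonMangoldt_nonneg, abs_of_pos hsq, abs_of_pos hℓ]
  have hΛ : Λ n ≤ Real.log n := ArithmeticFunction.vonMangoldt_le_log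
  have hg : ‖gDil τ (Real.log n)‖ ≤ bumpMass := norm_gDil_le _ _
  have hph : ‖(n : ℂ) ^ ((h : ℂ) * I) - 1‖ ≤ 2 := by
    calc ‖(n : ℂ) ^ ((h : ℂ) * I) - 1‖ ≤ ‖(n : ℂ) ^ ((h : ℂ) * I)‖ + ‖(1 : ℂ)‖ := norm_sub_le _ _
      _ = 2 := by rw [norm_natCast_cpow n hn0, norm_one]; norm_num
  have h2 : ‖(2 : ℂ)‖ = 2 := by simp
  rw [h2]
  have hbM := bumpMass_pos.le
  calc 2 * Λ n * ‖gDil τ (Real.log n)‖ / (Real.sqrt n * Real.log n) * ‖(n : ℂ) ^ ((h : ℂ) * I) - 1‖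
      ≤ 2 * Real.log n * bumpMass / (Real.sqrt n * Real.log n) * 2 := by
        refine mul_le_mul ?_ hph (norm_nonneg _) (by positivity)
        exact div_le_div_of_nonneg_right (mul_le_mul (mul_le_mul_of_nonneg_left hΛ (by norm_num)) hg
          (norm_nonneg _) (by positivity)) (by positivity)
    _ = 4 * bumpMass / Real.sqrt n := by field_simp; ring

/-- For a prime `p`: `|b_p|² = 16 (Re g_τ(log p))² sin²(h log p/2)/p`. [folklore] -/
theorem norm_sq_deltaCoef_prime (τ h : ℝ) {p : ℕ} (hp : p.Prime) :
    ‖deltaCoef τ h p‖ ^ 2 = 16 * (gDil τ (Real.log p)).re ^ 2 * Real.sin (h * Real.log p / 2) ^ 2 / p := by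
  have hp0 : p ≠ 0 := hp.ne_zero
  have hp1 : (1 : ℝ) < p := by exact_mod_cast hp.one_lt
  have hℓ : 0 < Real.log p := Real.log_pos hp1
  have hsq : 0 < Real.sqrt p := Real.sqrt_pos.2 (by linarith)
  have hph : ‖(p : ℂ) ^ ((h : ℂ) * I) - 1‖ = |2 * Real.sin (h * Real.log p / 2)| := by
    rw [natCast_cpow_eq p hp0, show ((h * Real.log p : ℝ) : ℂ) * I = I * ((h * Real.log p : ℝ) : ℂ) by ring,
      Complex.norm_exp_I_mul_ofReal_sub_one, Real.norm_eq_abs]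
  rw [deltaCoef, ArithmeticFunction.vonMangoldt_apply_prime hp, gDil_eq_re τ (Real.log p), norm_mul, hph,
    show 2 * ((Real.log p : ℝ) : ℂ) * (((gDil τ (Real.log p)).re : ℝ) : ℂ) / ((Real.sqrt p : ℂ) * (Real.log p : ℂ)) =
      ((2 * (gDil τ (Real.log p)).re / Real.sqrt p : ℝ) : ℂ) by
        have hlc : Complex.log (p : ℂ) ≠ 0 := by
          rw [← Complex.natCast_log]; exact_mod_cast hℓ.ne'
        have hsc : (Real.sqrt p : ℂ) ≠ 0 := by exact_mod_cast hsq.ne'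
        push_cast; field_simp, Complex.norm_real,
    Real.norm_eq_abs, mul_pow, sq_abs, sq_abs, div_pow, Real.sq_sqrt (by positivity)]
  simp only [Complex.ofReal_re]
  ring

/-! ### Two elementary sums -/

/-- `∑_{n=1}^N n^{-1/2} ≤ 2√N`. [folklore] -/
theorem sum_inv_sqrt_le (N : ℕ) : ∑ n ∈ Finset.Icc 1 N, 1 / Real.sqrt n ≤ 2 * Real.sqrt N := by
  induction N with
  | zero => simp
  | succ N ih =>
    rw [Finset.sum_Icc_succ_top (by omega), Nat.cast_succ]
    have hN0 : (0 : ℝ) ≤ N := Nat.cast_nonneg N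
    have hs1 : 0 < Real.sqrt ((N : ℝ) + 1) := Real.sqrt_pos.2 (by linarith)
    have hs0 : 0 ≤ Real.sqrt (N : ℝ) := Real.sqrt_nonneg _
    -- `√(N+1) − √N ≥ 1/(2√(N+1))`
    have hkey : 1 / Real.sqrt ((N : ℝ) + 1) ≤ 2 * (Real.sqrt ((N : ℝ) + 1) - Real.sqrt N) := by
      have hprod : (Real.sqrt ((N : ℝ) + 1) - Real.sqrt N) * (Real.sqrt ((N : ℝ) + 1) + Real.sqrt N) = 1 := by
        have := Real.mul_self_sqrt (by linarith : (0 : ℝ) ≤ N + 1)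
        have := Real.mul_self_sqrt hN0
        nlinarith
      have hle : Real.sqrt (N : ℝ) ≤ Real.sqrt ((N : ℝ) + 1) := Real.sqrt_le_sqrt (by linarith)
      rw [div_le_iff₀ hs1]
      nlinarith
    linarith

/-- `∑_{m=2}^{N} 1/(m(m−1)) ≤ 1` (telescoping). [folklore] -/
theorem sum_inv_mul_pred_le (N : ℕ) : ∑ m ∈ Finset.Icc 2 N, 1 / ((m : ℝ) * ((m : ℝ) - 1)) ≤ 1 := by
  suffices h : ∀ N : ℕ, 1 ≤ N → ∑ m ∈ Finset.Icc 2 N, 1 / ((m : ℝ) * ((m : ℝ) - 1)) = 1 - 1 / N by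
    rcases Nat.eq_zero_or_pos N with h0 | hpos
    · subst h0; simp
    · rw [h N hpos]
      have : (0 : ℝ) ≤ 1 / N := by positivity
      linarith
  intro N hN
  induction N with
  | zero => omega
  | succ N ih =>
    rcases Nat.eq_zero_or_pos N with h0 | hpos
    · subst h0; simp
    · rw [Finset.sum_Icc_succ_top (by omega), ih hpos, Nat.cast_succ, show ((N : ℝ) + 1 - 1) = N by ring]
      have hN0 : (0 : ℝ) < N := by exact_mod_cast hpos
      have hN1 : (0 : ℝ) < N + 1 := by linarith
      field_simp
      ring

/-- **`∑_{n ≤ N, n = p^k, k ≥ 2} 1/n ≤ 1`**: the higher prime powers have a convergent reciprocal sum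
(`∑_p ∑_{k≥2} p^{-k} = ∑_p 1/(p(p−1)) ≤ ∑_{m≥2} 1/(m(m−1)) = 1`). [folklore] -/
theorem sum_inv_higherPrimePow_le (N : ℕ) :
    ∑ n ∈ (Finset.Icc 1 N).filter (fun n => IsPrimePow n ∧ ¬ n.Prime), (1 : ℝ) / n ≤ 1 := by
  set PP := (Finset.Icc 1 N).filter (fun n => IsPrimePow n ∧ ¬ n.Prime) with hPP
  set φ : ℕ → ℕ × ℕ := fun n => (n.minFac, n.factorization n.minFac) with hφ
  have hmemPP : ∀ n ∈ PP, IsPrimePow n ∧ ¬ n.Prime ∧ 1 ≤ n ∧ n ≤ N := fun n hn => by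
    rw [hPP, Finset.mem_filter, Finset.mem_Icc] at hn
    exact ⟨hn.2.1, hn.2.2, hn.1.1, hn.1.2⟩
  have hrepr : ∀ n ∈ PP, n.minFac ^ (n.factorization n.minFac) = n := fun n hn =>
    (hmemPP n hn).1.minFac_pow_factorization_eq
  have hinj : Set.InjOn φ PP := by
    intro a ha b hb hab
    simp only [hφ, Prod.mk.injEq] at hab
    obtain ⟨h1, h2⟩ := hab
    have ea := hrepr a ha
    have eb := hrepr b hb
    rw [h1] at ea h2
    rw [h2] at ea
    exact ea.symm.trans eb
  -- the image lies in `primes ≤ N × [2, N]`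
  have himg : PP.image φ ⊆ ((Finset.Icc 1 N).filter Nat.Prime) ×ˢ Finset.Icc 2 N := by
    intro x hx
    rw [Finset.mem_image] at hx
    obtain ⟨n, hn, rfl⟩ := hx
    obtain ⟨hpp, hnp, h1, hnN⟩ := hmemPP n hn
    have hn1 : n ≠ 1 := hpp.ne_one
    have hpr : n.minFac.Prime := Nat.minFac_prime hn1
    have hk : 2 ≤ n.factorization n.minFac := by
      by_contra hk
      push Not at hk
      have hk0 : n.factorization n.minFac ≠ 0 := Nat.factorization_minFac_ne_zero (by omega)
      have hk1 : n.factorization n.minFac = 1 := by omega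
      have := hrepr n hn
      rw [hk1, pow_one] at this
      exact hnp (this ▸ hpr)
    have hkN : n.factorization n.minFac ≤ N := by
      have h2 : n.factorization n.minFac < n.minFac ^ n.factorization n.minFac :=
        Nat.lt_pow_self hpr.one_lt
      rw [hrepr n hn] at h2
      omega
    simp only [hφ, Finset.mem_product, Finset.mem_filter, Finset.mem_Icc]
    exact ⟨⟨⟨hpr.one_lt.le, (Nat.minFac_le (by omega)).trans hnN⟩, hpr⟩, hk, hkN⟩
  -- rewrite the sum over the image
  have hsum : ∑ n ∈ PP, (1 : ℝ) / n = ∑ x ∈ PP.image φ, (1 : ℝ) / ((x.1 : ℝ) ^ x.2) := by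
    rw [Finset.sum_image hinj]
    refine Finset.sum_congr rfl fun n hn => ?_
    simp only [hφ]
    rw [← Nat.cast_pow, hrepr n hn]
  rw [hsum]
  calc ∑ x ∈ PP.image φ, (1 : ℝ) / ((x.1 : ℝ) ^ x.2)
      ≤ ∑ x ∈ ((Finset.Icc 1 N).filter Nat.Prime) ×ˢ Finset.Icc 2 N, (1 : ℝ) / ((x.1 : ℝ) ^ x.2) :=
        Finset.sum_le_sum_of_subset_of_nonneg himg fun x _ _ => by positivity
    _ = ∑ p ∈ (Finset.Icc 1 N).filter Nat.Prime, ∑ k ∈ Finset.Icc 2 N, (1 / (p : ℝ)) ^ k := by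
        rw [Finset.sum_product]
        refine Finset.sum_congr rfl fun p _ => Finset.sum_congr rfl fun k _ => ?_
        rw [one_div_pow]
    _ ≤ ∑ p ∈ (Finset.Icc 1 N).filter Nat.Prime, 1 / ((p : ℝ) * ((p : ℝ) - 1)) := by
        refine Finset.sum_le_sum fun p hp => ?_
        rw [Finset.mem_filter] at hp
        have hp2 : (2 : ℝ) ≤ p := by exact_mod_cast hp.2.two_le
        have hx0 : (0 : ℝ) ≤ 1 / p := by positivity
        have hx1 : 1 / (p : ℝ) < 1 := by rw [div_lt_one (by linarith)]; linarith
        have hgeom := geom_sum_Ico_le_of_lt_one (m := 2) (n := N + 1) hx0 hx1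
        have hIco : Finset.Ico 2 (N + 1) = Finset.Icc 2 N := by ext a; simp
        rw [hIco] at hgeom
        refine hgeom.trans (le_of_eq ?_)
        have hp0 : (p : ℝ) ≠ 0 := by linarith
        have hp1 : (p : ℝ) - 1 ≠ 0 := by linarith
        field_simp
    _ ≤ ∑ m ∈ Finset.Icc 2 N, 1 / ((m : ℝ) * ((m : ℝ) - 1)) := by
        refine Finset.sum_le_sum_of_subset_of_nonneg ?_ fun m hm _ => ?_
        · intro p hp
          rw [Finset.mem_filter, Finset.mem_Icc] at hp
          rw [Finset.mem_Icc]; exact ⟨hp.2.two_le, hp.1.2⟩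
        · rw [Finset.mem_Icc] at hm
          have : (2 : ℝ) ≤ m := by exact_mod_cast hm.1
          have : 0 < (m : ℝ) * ((m : ℝ) - 1) := by nlinarith
          positivity
    _ ≤ 1 := sum_inv_mul_pred_le N

/-! ### Aggregate bounds for the coefficients -/

/-- `∑_{p ≤ N} p |b_p|² ≤ 16 ‖bump‖₁² N`. [folklore] -/
theorem sum_mul_norm_sq_deltaCoef_prime_le (τ h : ℝ) (N : ℕ) :
    ∑ p ∈ (Finset.Icc 1 N).filter Nat.Prime, (p : ℝ) * ‖deltaCoef τ h p‖ ^ 2 ≤ 16 * bumpMass ^ 2 * N := by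
  have hb := bumpMass_pos
  calc ∑ p ∈ (Finset.Icc 1 N).filter Nat.Prime, (p : ℝ) * ‖deltaCoef τ h p‖ ^ 2
      ≤ ∑ p ∈ (Finset.Icc 1 N).filter Nat.Prime, 16 * bumpMass ^ 2 := by
        refine Finset.sum_le_sum fun p hp => ?_
        rw [Finset.mem_filter] at hp
        have hp0 : (0 : ℝ) < p := by exact_mod_cast hp.2.pos
        have h1 := norm_deltaCoef_le τ h p
        have h2 : ‖deltaCoef τ h p‖ ^ 2 ≤ (4 * bumpMass / Real.sqrt p) ^ 2 := pow_le_pow_left₀ (norm_nonneg _) h1 2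
        rw [div_pow, Real.sq_sqrt hp0.le] at h2
        calc (p : ℝ) * ‖deltaCoef τ h p‖ ^ 2 ≤ p * ((4 * bumpMass) ^ 2 / p) := mul_le_mul_of_nonneg_left h2 hp0.le
          _ = 16 * bumpMass ^ 2 := by field_simp; ring
    _ = ((Finset.Icc 1 N).filter Nat.Prime).card * (16 * bumpMass ^ 2) := by rw [Finset.sum_const, nsmul_eq_mul]
    _ ≤ N * (16 * bumpMass ^ 2) := by
        refine mul_le_mul_of_nonneg_right ?_ (by positivity)
        have := Finset.card_filter_le (Finset.Icc 1 N) Nat.Prime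
        rw [Nat.card_Icc] at this
        exact_mod_cast (by omega : ((Finset.Icc 1 N).filter Nat.Prime).card ≤ N)
    _ = 16 * bumpMass ^ 2 * N := by ring

/-- `(∑_{p ≤ N} |b_p|)² ≤ 64 ‖bump‖₁² N`. [folklore] -/
theorem sq_sum_norm_deltaCoef_prime_le (τ h : ℝ) (N : ℕ) :
    (∑ p ∈ (Finset.Icc 1 N).filter Nat.Prime, ‖deltaCoef τ h p‖) ^ 2 ≤ 64 * bumpMass ^ 2 * N := by
  have hb := bumpMass_pos
  have h1 : ∑ p ∈ (Finset.Icc 1 N).filter Nat.Prime, ‖deltaCoef τ h p‖ ≤ 4 * bumpMass * (2 * Real.sqrt N) := by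
    calc ∑ p ∈ (Finset.Icc 1 N).filter Nat.Prime, ‖deltaCoef τ h p‖
        ≤ ∑ n ∈ Finset.Icc 1 N, ‖deltaCoef τ h n‖ :=
          Finset.sum_le_sum_of_subset_of_nonneg (Finset.filter_subset _ _) fun n _ _ => norm_nonneg _
      _ ≤ ∑ n ∈ Finset.Icc 1 N, 4 * bumpMass * (1 / Real.sqrt n) := by
          refine Finset.sum_le_sum fun n _ => ?_
          rw [mul_one_div]; exact norm_deltaCoef_le τ h n
      _ = 4 * bumpMass * ∑ n ∈ Finset.Icc 1 N, 1 / Real.sqrt n := by rw [Finset.mul_sum]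
      _ ≤ 4 * bumpMass * (2 * Real.sqrt N) := mul_le_mul_of_nonneg_left (sum_inv_sqrt_le N) (by positivity)
  have h0 : 0 ≤ ∑ p ∈ (Finset.Icc 1 N).filter Nat.Prime, ‖deltaCoef τ h p‖ := Finset.sum_nonneg fun _ _ => norm_nonneg _
  calc (∑ p ∈ (Finset.Icc 1 N).filter Nat.Prime, ‖deltaCoef τ h p‖) ^ 2 ≤ (4 * bumpMass * (2 * Real.sqrt N)) ^ 2 :=
        pow_le_pow_left₀ h0 h1 2
    _ = 64 * bumpMass ^ 2 * N := by rw [mul_pow, mul_pow, mul_pow, Real.sq_sqrt (Nat.cast_nonneg N)]; ring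

/-- The higher-prime-power coefficients: `∑_{n ≤ N, n not prime} |b_n|² ≤ 16 ‖bump‖₁²`. [folklore] -/
theorem sum_norm_sq_deltaCoef_pp_le (τ h : ℝ) (N : ℕ) :
    ∑ n ∈ Finset.Icc 1 N, ‖(if n.Prime then 0 else deltaCoef τ h n)‖ ^ 2 ≤ 16 * bumpMass ^ 2 := by
  have hb := bumpMass_pos
  have hsplit : ∑ n ∈ Finset.Icc 1 N, ‖(if n.Prime then 0 else deltaCoef τ h n)‖ ^ 2 =
      ∑ n ∈ (Finset.Icc 1 N).filter (fun n => IsPrimePow n ∧ ¬ n.Prime), ‖deltaCoef τ h n‖ ^ 2 := by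
    rw [Finset.sum_filter]
    refine Finset.sum_congr rfl fun n _ => ?_
    by_cases hp : n.Prime
    · simp [hp]
    · by_cases hpp : IsPrimePow n
      · simp [hp, hpp]
      · have : deltaCoef τ h n = 0 :=
          deltaCoef_eq_zero_of_vonMangoldt (ArithmeticFunction.vonMangoldt_eq_zero_iff.2 hpp)
        simp [hp, hpp, this]
  rw [hsplit]
  calc ∑ n ∈ (Finset.Icc 1 N).filter (fun n => IsPrimePow n ∧ ¬ n.Prime), ‖deltaCoef τ h n‖ ^ 2
      ≤ ∑ n ∈ (Finset.Icc 1 N).filter (fun n => IsPrimePow n ∧ ¬ n.Prime), 16 * bumpMass ^ 2 * ((1 : ℝ) / n) := by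
        refine Finset.sum_le_sum fun n hn => ?_
        rw [Finset.mem_filter, Finset.mem_Icc] at hn
        have hn0 : (0 : ℝ) < n := by exact_mod_cast hn.1.1
        have h2 : ‖deltaCoef τ h n‖ ^ 2 ≤ (4 * bumpMass / Real.sqrt n) ^ 2 :=
          pow_le_pow_left₀ (norm_nonneg _) (norm_deltaCoef_le τ h n) 2
        rw [div_pow, Real.sq_sqrt hn0.le] at h2
        refine h2.trans (le_of_eq ?_)
        field_simp; ring
    _ = 16 * bumpMass ^ 2 * ∑ n ∈ (Finset.Icc 1 N).filter (fun n => IsPrimePow n ∧ ¬ n.Prime), (1 : ℝ) / n := by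
        rw [Finset.mul_sum]
    _ ≤ 16 * bumpMass ^ 2 * 1 := mul_le_mul_of_nonneg_left (sum_inv_higherPrimePow_le N) (by positivity)
    _ = 16 * bumpMass ^ 2 := mul_one _

/-- `∑_{n ≤ N, n not prime} n |b_n|² ≤ 16 ‖bump‖₁² N`. [folklore] -/
theorem sum_mul_norm_sq_deltaCoef_pp_le (τ h : ℝ) (N : ℕ) :
    ∑ n ∈ Finset.Icc 1 N, (n : ℝ) * ‖(if n.Prime then 0 else deltaCoef τ h n)‖ ^ 2 ≤ 16 * bumpMass ^ 2 * N := by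
  have hb := bumpMass_pos
  calc ∑ n ∈ Finset.Icc 1 N, (n : ℝ) * ‖(if n.Prime then 0 else deltaCoef τ h n)‖ ^ 2
      ≤ ∑ n ∈ Finset.Icc 1 N, 16 * bumpMass ^ 2 := by
        refine Finset.sum_le_sum fun n hn => ?_
        rw [Finset.mem_Icc] at hn
        have hn0 : (0 : ℝ) < n := by exact_mod_cast hn.1
        by_cases hp : n.Prime
        · simp [hp]; positivity
        · simp only [hp, if_false]
          have h2 : ‖deltaCoef τ h n‖ ^ 2 ≤ (4 * bumpMass / Real.sqrt n) ^ 2 :=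
            pow_le_pow_left₀ (norm_nonneg _) (norm_deltaCoef_le τ h n) 2
          rw [div_pow, Real.sq_sqrt hn0.le] at h2
          calc (n : ℝ) * ‖deltaCoef τ h n‖ ^ 2 ≤ n * ((4 * bumpMass) ^ 2 / n) := mul_le_mul_of_nonneg_left h2 hn0.le
            _ = 16 * bumpMass ^ 2 := by field_simp; ring
    _ = N * (16 * bumpMass ^ 2) := by rw [Finset.sum_const, Nat.card_Icc, nsmul_eq_mul]; simp
    _ = 16 * bumpMass ^ 2 * N := by ring

/-! ### The higher prime powers are `O(W)` in `L¹` -/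

/-- **The higher prime powers in `L¹`.** On a window `[U₁, U₂]` of length `W ≥ 1856 N`,
`∫_{U₁}^{U₂} |∑_{n ≤ N, n not prime} b_n n^{iu}| du ≤ 6 ‖bump‖₁ W` (Cauchy–Schwarz and the
mean value theorem; an absolute constant thanks to `∑_{k≥2} ∑_p p^{-k} < ∞`). [cite: Titchmarsh1986, §9.26] -/
theorem integral_norm_ppPoly_le (τ h : ℝ) (N : ℕ) {U₁ U₂ : ℝ} (hU : U₁ ≤ U₂) (hN : 1856 * (N : ℝ) ≤ U₂ - U₁) :
    ∫ u in U₁..U₂, ‖∑ n ∈ Finset.Icc 1 N, (if n.Prime then 0 else deltaCoef τ h n) * (n : ℂ) ^ ((u : ℂ) * I)‖ ≤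
      6 * bumpMass * (U₂ - U₁) := by
  have hb := bumpMass_pos
  have hW0 : 0 ≤ U₂ - U₁ := by linarith
  have hcont : Continuous fun u : ℝ => ∑ n ∈ Finset.Icc 1 N, (if n.Prime then 0 else deltaCoef τ h n) * (n : ℂ) ^ ((u : ℂ) * I) :=
    continuous_dirichletPoly N (fun n => if n.Prime then 0 else deltaCoef τ h n)
  -- Cauchy–Schwarz against `1`
  have hCS := Gallagher.integral_mul_le_sqrt_mul_sqrt hU continuous_const (hcont.norm)
    (u := fun _ => (1 : ℝ)) (v := fun u => ‖∑ n ∈ Finset.Icc 1 N, (if n.Prime then 0 else deltaCoef τ h n) * (n : ℂ) ^ ((u : ℂ) * I)‖)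
  simp only [one_mul, one_pow, intervalIntegral.integral_const, smul_eq_mul, mul_one] at hCS
  -- the mean square
  have hMV := abs_integral_norm_sq_dirichletPoly_sub_le N (fun n => if n.Prime then 0 else deltaCoef τ h n) U₁ U₂
  have h1 := sum_norm_sq_deltaCoef_pp_le τ h N
  have h2 := sum_mul_norm_sq_deltaCoef_pp_le τ h N
  have hms : ∫ u in U₁..U₂, ‖∑ n ∈ Finset.Icc 1 N, (if n.Prime then 0 else deltaCoef τ h n) * (n : ℂ) ^ ((u : ℂ) * I)‖ ^ 2 ≤
      32 * bumpMass ^ 2 * (U₂ - U₁) := by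
    have := (abs_le.1 hMV).2
    have h3 : (U₂ - U₁) * ∑ n ∈ Finset.Icc 1 N, ‖(if n.Prime then 0 else deltaCoef τ h n)‖ ^ 2 ≤ (U₂ - U₁) * (16 * bumpMass ^ 2) :=
      mul_le_mul_of_nonneg_left h1 hW0
    nlinarith
  calc ∫ u in U₁..U₂, ‖∑ n ∈ Finset.Icc 1 N, (if n.Prime then 0 else deltaCoef τ h n) * (n : ℂ) ^ ((u : ℂ) * I)‖
      ≤ Real.sqrt (U₂ - U₁) * Real.sqrt (∫ u in U₁..U₂, ‖∑ n ∈ Finset.Icc 1 N, (if n.Prime then 0 else deltaCoef τ h n) * (n : ℂ) ^ ((u : ℂ) * I)‖ ^ 2) := hCS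
    _ ≤ Real.sqrt (U₂ - U₁) * Real.sqrt (32 * bumpMass ^ 2 * (U₂ - U₁)) :=
        mul_le_mul_of_nonneg_left (Real.sqrt_le_sqrt hms) (Real.sqrt_nonneg _)
    _ = Real.sqrt 32 * bumpMass * (U₂ - U₁) := by
        rw [Real.sqrt_mul (by positivity), Real.sqrt_mul (by positivity), Real.sqrt_sq hb.le]
        have := Real.mul_self_sqrt hW0
        ring_nf
        rw [Real.sq_sqrt hW0]
        ring
    _ ≤ 6 * bumpMass * (U₂ - U₁) := by
        refine mul_le_mul_of_nonneg_right (mul_le_mul_of_nonneg_right ?_ hb.le) hW0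
        rw [Real.sqrt_le_left (by norm_num)]; norm_num

/-! ### The variance from below -/

/-- `g_τ(log p) ≥ g₀(0)/2` for `p ≤ e^{ε₀ τ}` when `Re g₀ ≥ g₀(0)/2` on `[-ε₀, ε₀]`. [folklore] -/
theorem re_gDil_log_ge {τ ε₀ : ℝ} (hτ : 0 < τ) (hg : ∀ v : ℝ, |v| ≤ ε₀ → (g0 0).re / 2 ≤ (g0 v).re)
    {p : ℕ} (hp1 : 1 ≤ p) (hpQ : (p : ℝ) ≤ Real.exp (ε₀ * τ)) :
    (g0 0).re / 2 ≤ (gDil τ (Real.log p)).re := by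
  have hp0 : (0 : ℝ) < p := by exact_mod_cast hp1
  have hlog0 : 0 ≤ Real.log p := Real.log_nonneg (by exact_mod_cast hp1)
  have hlog : Real.log p ≤ ε₀ * τ := by
    rw [← Real.log_exp (ε₀ * τ)]; exact Real.log_le_log hp0 hpQ
  unfold gDil
  refine hg _ ?_
  rw [abs_of_nonneg (div_nonneg hlog0 hτ.le), div_le_iff₀ hτ]
  exact hlog

/-- **The variance of the prime side** (Titchmarsh (9.25.2)): for `0 < h ≤ 1`, `τ > 0`,
`0 < ε₀ ≤ 1/4` with `Re g₀ ≥ g₀(0)/2` on `[-ε₀, ε₀]`, and `ε₀ τ h ≥ 1`,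
`∑_{p ≤ e^{τ/4}} |b_p|² ≥ 4 g₀(0)² (½ log(ε₀τh) − 9h − 3/2 − 2h log(ε₀τh))`.
[cite: Titchmarsh1986, §9.25 (9.25.2)] -/
theorem variance_ge {τ h ε₀ : ℝ} (hτ : 0 < τ) (hh : 0 < h) (hh1 : h ≤ 1) (hε₀ : 0 < ε₀) (hε4 : ε₀ ≤ 1 / 4)
    (hg : ∀ v : ℝ, |v| ≤ ε₀ → (g0 0).re / 2 ≤ (g0 v).re) (hPQ : 1 ≤ ε₀ * τ * h) :
    4 * (g0 0).re ^ 2 * (Real.log (ε₀ * τ * h) / 2 - 9 * h - 3 / 2 - 2 * h * Real.log (ε₀ * τ * h)) ≤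
      ∑ p ∈ (Finset.Icc 1 (nCut τ)).filter Nat.Prime, ‖deltaCoef τ h p‖ ^ 2 := by
  have hg0 := g0_zero_re_pos
  set P := Real.exp (1 / h) with hPdef
  set Q := Real.exp (ε₀ * τ) with hQdef
  have hP2 : 2 ≤ P := by
    have h1h : 1 ≤ 1 / h := by rw [le_div_iff₀ hh]; linarith
    have := Real.add_one_le_exp (1 / h)
    rw [hPdef]; linarith
  have hPQ' : P ≤ Q := by
    rw [hPdef, hQdef]; refine Real.exp_le_exp.2 ?_
    rw [div_le_iff₀ hh]; linarith
  have hM := MertensBound.sum_sin_sq_log_div_prime_ge hh hP2 hPQ'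
  rw [hPdef, hQdef, Real.log_exp, Real.log_exp] at hM
  -- simplify the Mertens expression
  have hsimp : (Real.log (ε₀ * τ) - Real.log (1 / h)) / 2 - 9 / (1 / h) - 3 / (2 * h * (1 / h)) -
      2 * h * Real.log (ε₀ * τ / (1 / h)) =
      Real.log (ε₀ * τ * h) / 2 - 9 * h - 3 / 2 - 2 * h * Real.log (ε₀ * τ * h) := by
    have e1 : Real.log (ε₀ * τ) - Real.log (1 / h) = Real.log (ε₀ * τ * h) := by
      rw [one_div, Real.log_inv, sub_neg_eq_add, ← Real.log_mul (by positivity) hh.ne']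
    have e2 : ε₀ * τ / (1 / h) = ε₀ * τ * h := by field_simp
    rw [e1, e2]
    field_simp
  rw [hsimp] at hM
  -- the Mertens range is inside the prime range of `𝒱_τ`
  set Mset := (Finset.Ioc ⌊P⌋₊ ⌊Q⌋₊).filter Nat.Prime with hMset
  have hsub : Mset ⊆ (Finset.Icc 1 (nCut τ)).filter Nat.Prime := by
    intro p hp
    rw [hMset, Finset.mem_filter, Finset.mem_Ioc] at hp
    rw [Finset.mem_filter, Finset.mem_Icc]
    refine ⟨⟨hp.2.one_lt.le, hp.1.2.trans ?_⟩, hp.2⟩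
    unfold nCut
    exact Nat.floor_mono (Real.exp_le_exp.2 (by nlinarith))
  have hterm : ∀ p ∈ Mset, 4 * (g0 0).re ^ 2 * (Real.sin (h * Real.log p / 2) ^ 2 / p) ≤ ‖deltaCoef τ h p‖ ^ 2 := by
    intro p hp
    rw [hMset, Finset.mem_filter, Finset.mem_Ioc] at hp
    have hpr := hp.2
    have hpQ : (p : ℝ) ≤ Q := by
      have h1 : ((⌊Q⌋₊ : ℕ) : ℝ) ≤ Q := Nat.floor_le (Real.exp_pos _).le
      exact le_trans (by exact_mod_cast hp.1.2) h1
    have hgr := re_gDil_log_ge hτ hg hpr.one_lt.le hpQ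
    rw [norm_sq_deltaCoef_prime τ h hpr]
    have hp0 : (0 : ℝ) < p := by exact_mod_cast hpr.pos
    have hsq : ((g0 0).re / 2) ^ 2 ≤ (gDil τ (Real.log p)).re ^ 2 := pow_le_pow_left₀ (by linarith) hgr 2
    have hs0 : 0 ≤ Real.sin (h * Real.log p / 2) ^ 2 / p := by positivity
    calc 4 * (g0 0).re ^ 2 * (Real.sin (h * Real.log p / 2) ^ 2 / p)
        = 16 * ((g0 0).re / 2) ^ 2 * (Real.sin (h * Real.log p / 2) ^ 2 / p) := by ring
      _ ≤ 16 * (gDil τ (Real.log p)).re ^ 2 * (Real.sin (h * Real.log p / 2) ^ 2 / p) :=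
          mul_le_mul_of_nonneg_right (mul_le_mul_of_nonneg_left hsq (by norm_num)) hs0
      _ = _ := by ring
  calc 4 * (g0 0).re ^ 2 * (Real.log (ε₀ * τ * h) / 2 - 9 * h - 3 / 2 - 2 * h * Real.log (ε₀ * τ * h))
      ≤ 4 * (g0 0).re ^ 2 * ∑ p ∈ Mset, Real.sin (h * Real.log p / 2) ^ 2 / p :=
        mul_le_mul_of_nonneg_left hM (by positivity)
    _ = ∑ p ∈ Mset, 4 * (g0 0).re ^ 2 * (Real.sin (h * Real.log p / 2) ^ 2 / p) := by rw [Finset.mul_sum]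
    _ ≤ ∑ p ∈ Mset, ‖deltaCoef τ h p‖ ^ 2 := Finset.sum_le_sum hterm
    _ ≤ ∑ p ∈ (Finset.Icc 1 (nCut τ)).filter Nat.Prime, ‖deltaCoef τ h p‖ ^ 2 :=
        Finset.sum_le_sum_of_subset_of_nonneg hsub fun _ _ _ => sq_nonneg _

/-! ### The decomposition primes / higher prime powers -/

/-- `∑_{n ≤ N} b_n n^{iu} = ∑_{p ≤ N} b_p p^{iu} + ∑_{n ≤ N, n not prime} b_n n^{iu}` (the term
`n = 0` vanishes). [folklore] -/
theorem sum_range_eq_prime_add_pp (τ h u : ℝ) (N : ℕ) :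
    ∑ n ∈ Finset.range (N + 1), deltaCoef τ h n * (n : ℂ) ^ ((u : ℂ) * I) =
      ∑ p ∈ (Finset.Icc 1 N).filter Nat.Prime, deltaCoef τ h p * (p : ℂ) ^ ((u : ℂ) * I) +
        ∑ n ∈ Finset.Icc 1 N, (if n.Prime then 0 else deltaCoef τ h n) * (n : ℂ) ^ ((u : ℂ) * I) := by
  have h0 : deltaCoef τ h 0 = 0 := deltaCoef_eq_zero_of_vonMangoldt (by simp)
  -- `∑_{range (N+1)} = ∑_{Icc 1 N}`
  have hIcc : ∑ n ∈ Finset.range (N + 1), deltaCoef τ h n * (n : ℂ) ^ ((u : ℂ) * I) =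
      ∑ n ∈ Finset.Icc 1 N, deltaCoef τ h n * (n : ℂ) ^ ((u : ℂ) * I) := by
    rw [Finset.sum_range_succ', h0, zero_mul, add_zero, ← Finset.Ico_add_one_right_eq_Icc, Finset.sum_Ico_eq_sum_range,
      Nat.add_sub_cancel]
    exact Finset.sum_congr rfl fun i _ => by rw [add_comm]
  rw [hIcc, ← Finset.sum_filter_add_sum_filter_not (Finset.Icc 1 N) Nat.Prime]
  congr 1
  rw [Finset.sum_filter]
  refine Finset.sum_congr rfl fun n _ => ?_
  by_cases hp : n.Prime <;> simp [hp]

/-! ### The prime side from below -/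

/-- **The prime side of the smoothed `S(t+h) − S(t)` in `L¹`, from below.** There are absolute
`ε₀ > 0`, `B ≥ 0`, `C > 0` such that for `0 < h ≤ 1`, `τ > 0` with `ε₀ τ h ≥ 1` and
`2h log(ε₀τh) ≤ 1`, and a window `0 ≤ U₁ ≤ U₂`, `W = U₂ − U₁`, `2U₂ ≤ 5W`, `1856 (N+1)² ≤ W`,
`60000 ‖bump‖₁² (N+1) ≤ W` (`N = ⌊e^{τ/4}⌋`):
`∫_{U₁}^{U₂} |Re(𝒱_τ(u+h) − 𝒱_τ(u))| du ≥ W (√(2 g₀(0)² log(ε₀τh) − B)/20 − C)`.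
This is Selberg's lower bound for the main term of `∫ |S(t+h) − S(t)| dt` (Titchmarsh §9.26: first
moment of `Im Σ_p b_p p^{iu}` by Hölder between the second and fourth moments, variance
`≍ log(τ h)` by (9.25.2), higher prime powers negligible). [cite: Titchmarsh1986, §9.26] -/
theorem primeSide_lower : ∃ ε₀ B C : ℝ, 0 < ε₀ ∧ 0 ≤ B ∧ 0 < C ∧
    ∀ τ h U₁ U₂ : ℝ, 0 < h → h ≤ 1 → 0 < τ → 1 ≤ ε₀ * τ * h → 2 * h * Real.log (ε₀ * τ * h) ≤ 1 →
      0 ≤ U₁ → U₁ ≤ U₂ → 2 * U₂ ≤ 5 * (U₂ - U₁) → 1856 * ((nCut τ : ℝ) + 1) ^ 2 ≤ U₂ - U₁ →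
      60000 * bumpMass ^ 2 * ((nCut τ : ℝ) + 1) ≤ U₂ - U₁ →
      (U₂ - U₁) * (Real.sqrt (2 * (g0 0).re ^ 2 * Real.log (ε₀ * τ * h) - B) / 20 - C) ≤
        ∫ u in U₁..U₂, |(primeV τ (u + h) - primeV τ u).re| := by
  have hg0 := g0_zero_re_pos
  have hb := bumpMass_pos
  -- `ε₀` from the continuity of `g₀` at `0`
  obtain ⟨ε₁, hε₁, hε₁g⟩ : ∃ ε₁ > 0, ∀ v : ℝ, |v| ≤ ε₁ → (g0 0).re / 2 ≤ (g0 v).re := by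
    have hc : ContinuousAt (fun v => (g0 v).re) 0 := (Complex.continuous_re.comp continuous_g0).continuousAt
    rw [Metric.continuousAt_iff] at hc
    obtain ⟨δ, hδ, hδg⟩ := hc ((g0 0).re / 2) (by linarith)
    refine ⟨δ / 2, by linarith, fun v hv => ?_⟩
    have := hδg (x := v) (by rw [Real.dist_eq, sub_zero]; linarith)
    rw [Real.dist_eq] at this
    have := (abs_lt.1 this).1
    linarith
  set ε₀ := min ε₁ (1 / 4) with hε₀def
  have hε₀ : 0 < ε₀ := lt_min hε₁ (by norm_num)
  have hε4 : ε₀ ≤ 1 / 4 := min_le_right _ _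
  have hg : ∀ v : ℝ, |v| ≤ ε₀ → (g0 0).re / 2 ≤ (g0 v).re := fun v hv => hε₁g v (hv.trans (min_le_left _ _))
  refine ⟨ε₀, 46 * (g0 0).re ^ 2, 6 * bumpMass + 1, hε₀, by positivity, by positivity, ?_⟩
  intro τ h U₁ U₂ hh hh1 hτ hPQ hhlog hU₁ hU hU₂ hN1 hN2
  set N := nCut τ with hNdef
  set W := U₂ - U₁ with hW
  have hW0 : 0 ≤ W := by rw [hW]; linarith
  set Sp := (Finset.Icc 1 N).filter Nat.Prime with hSp
  set V := ∑ p ∈ Sp, ‖deltaCoef τ h p‖ ^ 2 with hVdef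
  have hV0 : 0 ≤ V := Finset.sum_nonneg fun _ _ => sq_nonneg _
  -- the variance
  have hVge : 2 * (g0 0).re ^ 2 * Real.log (ε₀ * τ * h) - 46 * (g0 0).re ^ 2 ≤ V := by
    have := variance_ge hτ hh hh1 hε₀ hε4 hg hPQ
    rw [← hNdef, ← hSp, ← hVdef] at this
    have hg2 : 0 ≤ (g0 0).re ^ 2 := sq_nonneg _
    nlinarith
  have hint0 : 0 ≤ ∫ u in U₁..U₂, |(primeV τ (u + h) - primeV τ u).re| :=
    intervalIntegral.integral_nonneg hU fun u _ => abs_nonneg _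
  -- the trivial case `V < 1`
  by_cases hV1 : V < 1
  · have hs : Real.sqrt (2 * (g0 0).re ^ 2 * Real.log (ε₀ * τ * h) - 46 * (g0 0).re ^ 2) ≤ 1 := by
      calc _ ≤ Real.sqrt V := Real.sqrt_le_sqrt hVge
        _ ≤ Real.sqrt 1 := Real.sqrt_le_sqrt hV1.le
        _ = 1 := Real.sqrt_one
    have : W * (Real.sqrt (2 * (g0 0).re ^ 2 * Real.log (ε₀ * τ * h) - 46 * (g0 0).re ^ 2) / 20 - (6 * bumpMass + 1)) ≤ 0 :=
      mul_nonpos_of_nonneg_of_nonpos hW0 (by linarith)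
    exact this.trans hint0
  push Not at hV1
  -- the main case: first moment of the prime polynomial and the higher prime powers
  have hP : ∀ p ∈ Sp, p.Prime := fun p hp => (Finset.mem_filter.1 hp).2
  have hSsub : Sp ⊆ Finset.Icc 1 N := Finset.filter_subset _ _
  have hN0 : (0 : ℝ) ≤ N := Nat.cast_nonneg N
  have hNW : 1856 * (N : ℝ) ^ 2 ≤ U₂ - U₁ := by
    have : (1856 : ℝ) * (N : ℝ) ^ 2 ≤ 1856 * ((N : ℝ) + 1) ^ 2 := by nlinarith
    linarith [hW]
  have hNW' : 1856 * (N : ℝ) ≤ U₂ - U₁ := by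
    have : (1856 : ℝ) * (N : ℝ) ≤ 1856 * ((N : ℝ) + 1) ^ 2 := by nlinarith
    linarith [hW]
  have hsmall : 1856 * (∑ p ∈ Sp, (p : ℝ) * ‖deltaCoef τ h p‖ ^ 2) + 4 * (∑ p ∈ Sp, ‖deltaCoef τ h p‖) ^ 2 ≤
      (U₂ - U₁) * V / 2 := by
    have a1 := sum_mul_norm_sq_deltaCoef_prime_le τ h N
    have a2 := sq_sum_norm_deltaCoef_prime_le τ h N
    rw [← hSp] at a1 a2
    have h3 : 29952 * bumpMass ^ 2 * N ≤ (U₂ - U₁) / 2 := by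
      have hb2 : 0 ≤ bumpMass ^ 2 := sq_nonneg _
      nlinarith [hW, mul_nonneg hb2 hN0]
    have h4 : (U₂ - U₁) / 2 ≤ (U₂ - U₁) * V / 2 := by nlinarith [hW]
    nlinarith
  have hfirst := first_moment_ge_window (a := deltaCoef τ h) hP hSsub hU₁ hU hU₂ hNW hsmall
  rw [← hVdef, ← hW] at hfirst
  have hpp := integral_norm_ppPoly_le τ h N hU hNW'
  rw [← hW] at hpp
  -- pointwise: `|Re Δ𝒱| ≥ |Im prime part| − |pp part|`
  have hpt : ∀ u : ℝ, |(∑ p ∈ Sp, deltaCoef τ h p * (p : ℂ) ^ ((u : ℂ) * I)).im| -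
      ‖∑ n ∈ Finset.Icc 1 N, (if n.Prime then 0 else deltaCoef τ h n) * (n : ℂ) ^ ((u : ℂ) * I)‖ ≤
      |(primeV τ (u + h) - primeV τ u).re| := by
    intro u
    rw [re_primeV_sub_eq, ← hNdef, sum_range_eq_prime_add_pp, ← hSp, Complex.add_im]
    have := Complex.abs_im_le_norm (∑ n ∈ Finset.Icc 1 N, (if n.Prime then 0 else deltaCoef τ h n) * (n : ℂ) ^ ((u : ℂ) * I))
    have htri := abs_add_le ((∑ p ∈ Sp, deltaCoef τ h p * (p : ℂ) ^ ((u : ℂ) * I)).im +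
        (∑ n ∈ Finset.Icc 1 N, (if n.Prime then 0 else deltaCoef τ h n) * (n : ℂ) ^ ((u : ℂ) * I)).im)
      (-(∑ n ∈ Finset.Icc 1 N, (if n.Prime then 0 else deltaCoef τ h n) * (n : ℂ) ^ ((u : ℂ) * I)).im)
    rw [add_neg_cancel_right, abs_neg] at htri
    linarith
  -- integrate
  have hcontP : Continuous fun u : ℝ => ∑ p ∈ Sp, deltaCoef τ h p * (p : ℂ) ^ ((u : ℂ) * I) :=
    continuous_primePoly hSsub
  have hcontQ : Continuous fun u : ℝ => ∑ n ∈ Finset.Icc 1 N, (if n.Prime then 0 else deltaCoef τ h n) * (n : ℂ) ^ ((u : ℂ) * I) :=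
    continuous_dirichletPoly N _
  have hcontV : Continuous fun u : ℝ => |(primeV τ (u + h) - primeV τ u).re| :=
    (Complex.continuous_re.comp (((continuous_primeV τ).comp (continuous_add_const h)).sub (continuous_primeV τ))).abs
  have hi1 : IntervalIntegrable (fun u : ℝ => |(∑ p ∈ Sp, deltaCoef τ h p * (p : ℂ) ^ ((u : ℂ) * I)).im|) volume U₁ U₂ :=
    ((Complex.continuous_im.comp hcontP).abs).intervalIntegrable _ _
  have hi2 : IntervalIntegrable (fun u : ℝ =>
      ‖∑ n ∈ Finset.Icc 1 N, (if n.Prime then 0 else deltaCoef τ h n) * (n : ℂ) ^ ((u : ℂ) * I)‖) volume U₁ U₂ :=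
    hcontQ.norm.intervalIntegrable _ _
  have hi3 : IntervalIntegrable (fun u : ℝ => |(primeV τ (u + h) - primeV τ u).re|) volume U₁ U₂ :=
    hcontV.intervalIntegrable _ _
  have hmono : ∫ u in U₁..U₂, (|(∑ p ∈ Sp, deltaCoef τ h p * (p : ℂ) ^ ((u : ℂ) * I)).im| -
      ‖∑ n ∈ Finset.Icc 1 N, (if n.Prime then 0 else deltaCoef τ h n) * (n : ℂ) ^ ((u : ℂ) * I)‖) ≤
      ∫ u in U₁..U₂, |(primeV τ (u + h) - primeV τ u).re| :=
    intervalIntegral.integral_mono_on hU (hi1.sub hi2) hi3 fun u _ => hpt u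
  rw [intervalIntegral.integral_sub hi1 hi2] at hmono
  have hsq : Real.sqrt (2 * (g0 0).re ^ 2 * Real.log (ε₀ * τ * h) - 46 * (g0 0).re ^ 2) ≤ Real.sqrt V :=
    Real.sqrt_le_sqrt hVge
  have : W * (Real.sqrt (2 * (g0 0).re ^ 2 * Real.log (ε₀ * τ * h) - 46 * (g0 0).re ^ 2) / 20 - (6 * bumpMass + 1)) ≤
      W * Real.sqrt V / 20 - 6 * bumpMass * W := by
    have := mul_le_mul_of_nonneg_left hsq hW0
    nlinarith
  linarith

end Literature.NumberTheory.LFunctions.SelbergDelta
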